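import Summits.HodgeConjecture.HodgeConjecture.Theorems.F0P3cStCharTSLdsuOut   -- ★ (LH6-p04 g5) «LDSU-OUT★»: `innerG_eq_neg_of_eq_neg_on_ellG` (2nd slot); brings ★ `EllLin` (`innerG_congr_left`, `innerG_smul_left`), ★ `Ch12Sec6`, ★ `Ch12Sec5Inputs`
import HarnessLib

/-!
# F0 · P3c · line LH6 «StCharTS» — «61C-OF-NORMS★»: PROPOSITION 12.6.1 (c) «`⟨χ_π, χ_{π′}⟩_e = −1`» DERIVED, AT A GENERIC §12.5 DATUM, FROM THE NORM-ONE
# SENTENCES (`⟨χ_σ, χ_σ⟩_e = 1` for square-integrable `σ`; `⟨χ_π, χ_π⟩_e = 1` for l.d.s. members) AND THE OPPOSITE-CHARACTER RELATIONS ON `G^e`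
# [Rogawski1990, §12.6 Prop. 12.6.1 (c) p. 188: «For (c), observe that `χ_π = −χ_{π′}` on `G^e`»]

Cell `pub/hodgecm-mathlib`, crux H413 = `stmt-HodgeConjecture-24833` (`--supports` lane, helper), route HCCMUnconditional; seat F0P2-p02 (g23) on the
LEAD's word over CENSUS «R0-PRINT-RESIDUE» v1 (F0P3a-p05 (g25), 39dfcb9e16e070c5) §2-K4 (3)(5)(7), §6.3 «label-shrinking K4 ↦ K4′».  THEOREMS ONLY,
sorry-free, no definition ∕ instance ∕ notation ∕ named fact; GENERIC over the TR carpet's posited datum `𝔇 : EllipticData G H` (nothing about `U(3)` is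
asserted).  HONEST LABEL: HC_CM is proved only modulo the 7 printed citations (2 remaining: hLiu418 = stmt-HodgeConjecture-24832, h413 =
stmt-HodgeConjecture-24833) until rung 0 closes; count-neutral (no leaf edition is implied: with ★ «OPP-23★» `F0P3cStCharTSOpp23.charOpposite_of_PS2`
supplying `hOpp` at the `U(Φ₃)(L⁺_v)` datum, the RUNG0 ∕ leaf pens may re-letter the block conjunct `Ch12Sec6.Prop1261c 𝔇` to the l.d.s. norm-one
sentence `hLdsOne` — exactly the sentence §13 owes — the kinds-2–3 instances and kind 1's «−1» being derived here).

THE MATHEMATICS (print p. 188).  `Prop. 12.6.1 (c)`: for `π ≠ π′` with `{π, π′}` of one of the three kinds (★ `IsEllipticPair`), `⟨χ_π, χ_{π′}⟩_e = −1`.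
KIND 1 (an l.d.s. packet `{π, π′}`): «`χ_{π} = −χ_{π′}` on `G^e`» (★ `Ch12Sec6.LdsCharactersOpposite`), so `⟨χ_π, χ_{π′}⟩_e = −⟨χ_π, χ_π⟩_e = −1` by the
l.d.s. norm-one sentence.  KINDS 2–3 (`{St_G(ψ), ψ∘det_G}`, `{π²(ξ), πⁿ(ξ)}`): exactly one member `σ` is square-integrable ((ST-L2)(DET), (PI2-L2)(PIN)), the
other `u` is not; «`χ_σ = −χ_u` on `G^e`» (`hOpp`, ★ «OPP-23★» at the model), so `⟨χ_σ, χ_u⟩_e = −⟨χ_σ, χ_σ⟩_e = −1` and `⟨χ_u, χ_σ⟩_e = −⟨χ_σ, χ_σ⟩_e = −1`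
by the square-integrable norm-one sentence (Prop. 12.6.1 (a), part 2).  The elliptic inner product sees values only `dγ`-a.e. on the elliptic Cartan
representatives, which lie a.e. in `G^e` ((C2) ★ `EllCartanAE`): ★ `F0P3cStCharTSLdsuOut.innerG_eq_neg_of_eq_neg_on_ellG` (second slot) and §1 below (first slot).

* §1 `innerG_eq_neg_of_eq_neg_on_ellG_left` — first-slot twin of ★ LDSU-OUT's lemma; `innerG_pair_of_opposite` — both orientations `= −1` from one norm.
* §2 `prop1261c_of_norms` — ★ `Ch12Sec6.Prop1261c 𝔇` from (C2), `LdsCharactersOpposite`, `hOpp` (kinds 2–3 opposite characters), the two norm-one sentences,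
  and the square-integrability sockets (ST-L2), (DET) ★ `DetNotL2`, (PI2-L2), (PIN) ★ `PiNNotL2`; `prop1261c_of_prop1261a` — the same with the square-integrable
  norm read from ★ `Ch12Sec6.Prop1261a` part 2 through (ELL) ★ `EllipticOfL2` (the block's own letters).

## References
* [Rogawski1990] J. D. Rogawski, *Automorphic Representations of Unitary Groups in Three Variables*, Ann. of Math. Stud. 123 (1990): §12.6 Prop. 12.6.1
  (a)(c) p. 188; §12.2 pp. 172–174; §12.5 p. 184.
-/

set_option autoImplicit false
-- the mandated namespace has the single-problem summit's repeated segment (`HodgeConjecture.HodgeConjecture`)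
set_option linter.dupNamespace false

noncomputable section

open MeasureTheory Filter Topology
open Literature.NumberTheory.Automorphic Literature.NumberTheory.Rogawski1990

namespace Summit.HodgeConjecture.HodgeConjecture.Cruxes.H413.F0P3cStCharTSProp1261cOfNorms

variable {G H : Type} [Group G] [TopologicalSpace G] [IsTopologicalGroup G] [MeasurableSpace G]
  [∀ γ : G, MeasurableSpace (G ⧸ Subgroup.centralizer ({γ} : Set G))] [MeasurableSpace (G ⧸ Subgroup.center G)]
  [Group H] [TopologicalSpace H] [IsTopologicalGroup H] [MeasurableSpace H]
  (𝔇 : Ch12Sec5.EllipticData G H)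

/-! ## §1 `⟨ , ⟩_{G,e}` against two class functions opposite on `G^e` — first slot, and the pair values -/

/-- **`⟨α, β⟩_{G,e} = −⟨α′, β⟩_{G,e}` when `α = −α′` on `G^e`** (first-slot twin of ★ `F0P3cStCharTSLdsuOut.innerG_eq_neg_of_eq_neg_on_ellG`), under (C2)
★ `EllCartanAE`: the elliptic inner product [§12.5 p. 184] only sees values a.e. on the elliptic tori (★ `innerG_congr_left`) and is homogeneous in the
first slot (★ `innerG_smul_left`). [cite: Rogawski1990, §12.5 p. 184] -/
theorem innerG_eq_neg_of_eq_neg_on_ellG_left (hC2 : 𝔇.EllCartanAE) (β : G → ℂ) {α α' : G → ℂ}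
    (h : ∀ γ ∈ 𝔇.ellG, α γ = -α' γ) :
    𝔇.innerG α β = -𝔇.innerG α' β := by
  have hae : ∀ T ∈ 𝔇.cartanG, ∀ᵐ t : ↥T ∂(𝔇.μT T), α (t : G) = ((-1 : ℂ) • α') (t : G) := fun T hT =>
    (hC2 T hT).mono fun t ht => by rw [Pi.smul_apply, smul_eq_mul, neg_one_mul]; exact h _ ht
  rw [F0P3cStCharTSEllLin.innerG_congr_left 𝔇 β hae, F0P3cStCharTSEllLin.innerG_smul_left 𝔇 (-1) α' β, neg_one_mul]

/-- **Both pair values from one norm**: if `χ_σ = −χ_u` on `G^e` and `⟨χ_σ, χ_σ⟩_e = 1`, then `⟨χ_u, χ_σ⟩_e = −1` and `⟨χ_σ, χ_u⟩_e = −1` (under (C2)).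
Print: «For (c), observe that `χ_π = −χ_{π′}` on `G^e`» [p. 188]. [cite: Rogawski1990, §12.6 Prop. 12.6.1 (c) p. 188; §12.5 p. 184] -/
theorem innerG_pair_of_opposite (hC2 : 𝔇.EllCartanAE) {u σ : IrrClass G}
    (hopp : ∀ γ ∈ 𝔇.ellG, 𝔇.char σ γ = -𝔇.char u γ) (hone : 𝔇.innerG (𝔇.char σ) (𝔇.char σ) = 1) :
    𝔇.innerG (𝔇.char u) (𝔇.char σ) = -1 ∧ 𝔇.innerG (𝔇.char σ) (𝔇.char u) = -1 := by
  have hopp' : ∀ γ ∈ 𝔇.ellG, 𝔇.char u γ = -𝔇.char σ γ := fun γ hγ => by rw [hopp γ hγ, neg_neg]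
  refine ⟨?_, ?_⟩
  · rw [innerG_eq_neg_of_eq_neg_on_ellG_left 𝔇 hC2 (𝔇.char σ) hopp', hone]
  · rw [F0P3cStCharTSLdsuOut.innerG_eq_neg_of_eq_neg_on_ellG 𝔇 hC2 (𝔇.char σ) hopp', hone]

/-! ## §2 PROPOSITION 12.6.1 (c) from the norm-one sentences -/

/-- **«61C-OF-NORMS★» — ★ `Ch12Sec6.Prop1261c 𝔇` («`⟨χ_π, χ_{π′}⟩_e = −1` for every pair of distinct classes of one of the three kinds») DERIVED at a generic
§12.5 datum** from: (C2) ★ `EllCartanAE`; «`χ_{π¹} = −χ_{π²}` on `G^e`» for l.d.s. packets (★ `Ch12Sec6.LdsCharactersOpposite`); the kinds-2–3 opposite-character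
relation `hOpp` («`χ_σ = −χ_π` on `G^e`» for `π` non-square-integrable, `σ` square-integrable, `{π, σ}` a pair — ★ «OPP-23★» at the `U(Φ₃)(L⁺_v)` datum, the
shape of the package's (PS2)); the NORM-ONE sentences `hL2one` (Prop. 12.6.1 (a) part 2: `⟨χ_σ, χ_σ⟩_e = 1` for square-integrable `σ` [H₄, C₄]) and `hLdsOne`
(`⟨χ_π, χ_π⟩_e = 1` for the members of an l.d.s. packet — print's tacit §13 input for kind 1); and the square-integrability sockets of §12.2: (ST-L2) `St_G(ψ)` IS
square-integrable, (DET) ★ `DetNotL2`, (PI2-L2) `π²(ξ)` IS square-integrable, (PIN) ★ `PiNNotL2` (orientation of kinds 2–3).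
[cite: Rogawski1990, §12.6 Prop. 12.6.1 (a)(c) p. 188; §12.2 pp. 172–174; §12.5 p. 184] -/
theorem prop1261c_of_norms (hC2 : 𝔇.EllCartanAE)
    (hLO : Ch12Sec6.LdsCharactersOpposite 𝔇)
    (hOpp : ∀ π σ : IrrClass G, ¬ 𝔇.IsL2 π → 𝔇.IsL2 σ → 𝔇.IsEllipticPair π σ → ∀ γ ∈ 𝔇.ellG, 𝔇.char σ γ = -𝔇.char π γ)
    (hL2one : ∀ σ : IrrClass G, 𝔇.IsL2 σ → 𝔇.innerG (𝔇.char σ) (𝔇.char σ) = 1)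
    (hLdsOne : ∀ P ∈ 𝔇.ldsPackets, ∀ π ∈ P, 𝔇.innerG (𝔇.char π) (𝔇.char π) = 1)
    (hStL2 : ∀ ψ : ↥(Subgroup.center G) →* ℂˣ, Continuous ψ → 𝔇.IsL2 (𝔇.stG ψ))
    (hDet : 𝔇.DetNotL2)
    (hPi2L2 : ∀ ξ : H →* ℂˣ, Continuous ξ → 𝔇.IsL2 (𝔇.pi2 ξ))
    (hPiN : 𝔇.PiNNotL2) :
    Ch12Sec6.Prop1261c 𝔇 := by
  intro π π' hne hpair
  -- kinds 2–3, in both orientations: `σ` the square-integrable member, `u` the other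
  have hkind : ∀ {u σ : IrrClass G}, ¬ 𝔇.IsL2 u → 𝔇.IsL2 σ → 𝔇.IsEllipticPair u σ →
      𝔇.innerG (𝔇.char u) (𝔇.char σ) = -1 ∧ 𝔇.innerG (𝔇.char σ) (𝔇.char u) = -1 :=
    fun {u σ} hu hσ hp => innerG_pair_of_opposite 𝔇 hC2 (hOpp u σ hu hσ hp) (hL2one σ hσ)
  rcases hpair with ⟨P, hP, hmem⟩ | ⟨ψ, hψ, hor⟩ | ⟨ξ, hξ, hor⟩
  · -- kind 1: an l.d.s. packet `{π, π′}`
    have hπ : π ∈ P := (hmem π).2 (Or.inl rfl)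
    have hπ' : π' ∈ P := (hmem π').2 (Or.inr rfl)
    have hopp : ∀ γ ∈ 𝔇.ellG, 𝔇.char π' γ = -𝔇.char π γ := hLO P hP π' hπ' π hπ hne.symm
    rw [F0P3cStCharTSLdsuOut.innerG_eq_neg_of_eq_neg_on_ellG 𝔇 hC2 (𝔇.char π) hopp, hLdsOne P hP π hπ]
  · -- kind 2: `{St_G(ψ), ψ∘det_G}`
    rcases hor with ⟨rfl, rfl⟩ | ⟨rfl, rfl⟩
    · -- `π = St_G(ψ)` (square-integrable), `π′ = ψ∘det_G`
      have hp : 𝔇.IsEllipticPair (𝔇.detG ψ) (𝔇.stG ψ) := Or.inr (Or.inl ⟨ψ, hψ, Or.inr ⟨rfl, rfl⟩⟩)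
      exact (hkind (hDet ψ hψ) (hStL2 ψ hψ) hp).2
    · -- `π = ψ∘det_G`, `π′ = St_G(ψ)`
      have hp : 𝔇.IsEllipticPair (𝔇.detG ψ) (𝔇.stG ψ) := Or.inr (Or.inl ⟨ψ, hψ, Or.inr ⟨rfl, rfl⟩⟩)
      exact (hkind (hDet ψ hψ) (hStL2 ψ hψ) hp).1
  · -- kind 3: `{π²(ξ), πⁿ(ξ)}`
    rcases hor with ⟨rfl, rfl⟩ | ⟨rfl, rfl⟩
    · -- `π = π²(ξ)` (square-integrable), `π′ = πⁿ(ξ)`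
      have hp : 𝔇.IsEllipticPair (𝔇.piN ξ) (𝔇.pi2 ξ) := Or.inr (Or.inr ⟨ξ, hξ, Or.inr ⟨rfl, rfl⟩⟩)
      exact (hkind (hPiN ξ hξ) (hPi2L2 ξ hξ) hp).2
    · -- `π = πⁿ(ξ)`, `π′ = π²(ξ)`
      have hp : 𝔇.IsEllipticPair (𝔇.piN ξ) (𝔇.pi2 ξ) := Or.inr (Or.inr ⟨ξ, hξ, Or.inr ⟨rfl, rfl⟩⟩)
      exact (hkind (hPiN ξ hξ) (hPi2L2 ξ hξ) hp).1

/-- **«61C-OF-NORMS★» in the block's own letters**: the same with the square-integrable norm read from ★ `Ch12Sec6.Prop1261a` (part 2) through (ELL)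
★ `EllipticOfL2` («square-integrable ⇒ elliptic», in house ★ `F0P3cStCharTSEllOut.ellipticOfL2_of_PL`).  Hence, at any datum carrying these letters, the block
conjunct `Ch12Sec6.Prop1261c 𝔇` is equivalent — given the rest of the block — to the l.d.s. norm-one sentence `hLdsOne`.
[cite: Rogawski1990, §12.6 Prop. 12.6.1 (a)(c) p. 188; §12.2 pp. 172–174] -/
theorem prop1261c_of_prop1261a (hC2 : 𝔇.EllCartanAE)
    (hLO : Ch12Sec6.LdsCharactersOpposite 𝔇)
    (hOpp : ∀ π σ : IrrClass G, ¬ 𝔇.IsL2 π → 𝔇.IsL2 σ → 𝔇.IsEllipticPair π σ → ∀ γ ∈ 𝔇.ellG, 𝔇.char σ γ = -𝔇.char π γ)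
    (h61a : Ch12Sec6.Prop1261a 𝔇) (hEll : 𝔇.EllipticOfL2)
    (hLdsOne : ∀ P ∈ 𝔇.ldsPackets, ∀ π ∈ P, 𝔇.innerG (𝔇.char π) (𝔇.char π) = 1)
    (hStL2 : ∀ ψ : ↥(Subgroup.center G) →* ℂˣ, Continuous ψ → 𝔇.IsL2 (𝔇.stG ψ))
    (hDet : 𝔇.DetNotL2)
    (hPi2L2 : ∀ ξ : H →* ℂˣ, Continuous ξ → 𝔇.IsL2 (𝔇.pi2 ξ))
    (hPiN : 𝔇.PiNNotL2) :
    Ch12Sec6.Prop1261c 𝔇 :=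
  prop1261c_of_norms 𝔇 hC2 hLO hOpp (fun σ hσ => (h61a σ (hEll σ hσ)).2 hσ) hLdsOne hStL2 hDet hPi2L2 hPiN

/-- **The converse direction of the re-lettering** (so that K4′ is not stronger than the block): ★ `Ch12Sec6.Prop1261c 𝔇` and «`χ_{π¹} = −χ_{π²}` on `G^e`»
give the l.d.s. norm-one sentence at every member `π` of a two-element l.d.s. packet `P = {π, π″}` ((LDS2) shape).
[cite: Rogawski1990, §12.6 Prop. 12.6.1 (c) p. 188; §12.2 (3) p. 174] -/
theorem ldsNormOne_of_prop1261c (hC2 : 𝔇.EllCartanAE)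
    (hLO : Ch12Sec6.LdsCharactersOpposite 𝔇) (h61c : Ch12Sec6.Prop1261c 𝔇)
    {P : Finset (IrrClass G)} (hP : P ∈ 𝔇.ldsPackets) {π π'' : IrrClass G} (hne : π ≠ π'')
    (hP2 : ∀ σ : IrrClass G, σ ∈ P ↔ (σ = π ∨ σ = π'')) :
    𝔇.innerG (𝔇.char π) (𝔇.char π) = 1 := by
  have hπ : π ∈ P := (hP2 π).2 (Or.inl rfl)
  have hπ'' : π'' ∈ P := (hP2 π'').2 (Or.inr rfl)
  have hc : 𝔇.innerG (𝔇.char π) (𝔇.char π'') = -1 := h61c π π'' hne (Or.inl ⟨P, hP, hP2⟩)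
  have hopp : ∀ γ ∈ 𝔇.ellG, 𝔇.char π'' γ = -𝔇.char π γ := hLO P hP π'' hπ'' π hπ hne.symm
  rw [F0P3cStCharTSLdsuOut.innerG_eq_neg_of_eq_neg_on_ellG 𝔇 hC2 (𝔇.char π) hopp, neg_inj] at hc
  exact hc

end Summit.HodgeConjecture.HodgeConjecture.Cruxes.H413.F0P3cStCharTSProp1261cOfNorms

end
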